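import Summits.BirchSwinnertonDyer.Rank1Residual.Supersingular.DescentLowerBound
import Literature.NumberTheory.EllipticCurves.Rank1Residual.Typed.HigherDescentCertificate
import Literature.NumberTheory.EllipticCurves.CongruenceVisibilityLocalFactors
import HarnessLib

/-!
# Print tier P-X6 (cell `bsd-print-x6`, seat p4): the explicit `p`-descent CERTIFICATE ROAD on the leaf
# `ClassX6 ∧ r_an = 0` — exact `#Sel^(p^k)(E/ℚ)` + Kato's upper bound (Wuthrich 2014 Prop. 21) ⟹
# `#Ш(E/ℚ)[p^∞] = p^{ord_p #Ш_an}`, i.e. Miller's `BSD(E,p)`; and the road is COMPLETE (an iff)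

PARTITION currency (D-0054): leaf A6 = corner `ClassX6 W p ∧ W.analyticRank = 0` of
`Summit.BirchSwinnertonDyer.Rank1Residual.bsdp_allCurves_of_not_corner_of_not_cornerF` (good supersingular
odd `p`, `E` semistable, `p ≥ 5 ∨ a₃ = 0`; `E[p]` irreducible and `ρ̄_{E,p}` onto are automatic,
`ClassX6.irr` / `ClassX6.surj`). Strategy sentence of this seat (director-bsd D-0131 (2), verbatim): «explicit
p-descent certificate road: Sel_p(E/ℚ) exactly (p-isogeny or full p-descent, two engines) + Kato's upper bound ⇒
#Ш[p^∞] = p^{ord_p Ш_an} on the non-unit cells». BEYOND-PRINT THEOREM: **NO** — every input is a PUBLISHED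
theorem taken by name (Wuthrich 2014 Prop. 21 = Kato's Euler-system bound made integral at the primes of
surjective-or-Borel image, `hW`; Gross–Zagier–Kolyvagin `hGZK`; modularity `hmod`) plus ONE finite per-curve
certificate line; the method is the one of Grigorov–Jorza–Patrikis–Stein–Tarniţǎ (Math. Comp. 78 (2009)) and
Miller (LMS JCM 14 (2011)). Closes the leaf PER PAIR, never class-wide; the class-wide residual is named below.

HONEST FRAMING. Nothing here is new mathematics and nothing is a class theorem: on the leaf the LOWER half
`ord_p #Ш_an ≤ ord_p #Ш` (`Typed.MissingLowerBoundAt`, = the Eisenstein half of Kobayashi's signed main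
conjecture, crux `KobayashiLowerHalfSemistable` of route `SignedLowerHalves`, item stmt-BirchSwinnertonDyer-19000;
announced by Burungale–Skinner–Tian–Wan arXiv:2409.01350 Thm. 1.3, PRE) is NOT in print; this file replaces it,
pair by pair, by a DECIDABLE certificate. What is new relative to the tree's certificate consumers
(`Typed/SelmerCardCertificateRankZero`, `Typed/CasselsLowerBound`, `Supersingular/DescentLowerBound`:
`Sel^(p) ≠ 0` + Cassels–Tate squareness, reach `ord_p #Ш_an ≤ 2` only; `Typed/HigherDescentCertificate`:
`#Sel` + a STABILISATION line, no upper bound; `X10/SurjThreeShaCells`: `#Sel^(3) = 9` at `p = 3` on X10):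
(i) the EXACT count `#Sel^(p^k)(E/ℚ) = p^m` at ANY prime power is turned into the lower half `m ≤ ord_p #Ш`
with NO Cassels–Tate pairing (bsd.S18 leaves the trust base) and NO bound on `m` — by Silverman X.4.2 (the
tree's PROVED descent count) `Sel^(p^k)(E/ℚ) ≅ Ш(E/ℚ)[p^k]` at a rank-`0` pair without rational `p`-torsion,
and Lagrange; (ii) on the leaf every side condition is DISCHARGED from `ClassX6` (not additive: good; image:
`ClassX6.surj`; `p ∤ #E(ℚ)_tors`: `ClassX6.irr` + Mazur), so the leaf closes per pair from the three published
facts + the one certificate line; (iii) the exact order `#Ш(E/ℚ)[p^∞] = p^m` is read off; (iv) COMPLETENESS: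
conversely `BSD(E,p)` on the leaf forces `#Sel^(p^k)(E/ℚ) = p^{ord_p #Ш_an}` for every `k ≥ ord_p #Ш(E/ℚ)` — so
on the leaf, granted the three published facts, `BSD(E,p) ↔ ∃ k m, #Sel^(p^k)(E/ℚ) = p^m ∧ ord_p #Ш_an = m`
(`X6.bsdp_rankZero_iff_exists_card_selmerGroup_primePow`): the certificate is EXACTLY as strong as the leaf's
obligation, and what is missing class-wide is precisely a UNIFORM reason for the certificate — the lower half.

CENSUS USE (per pair, N < 5·10⁵, board A6 of `pub/pub-bsdres/PARTITION-SCOREBOARD.md`): every non-unit A6 pair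
of record has `ord_p #Ш_an = 2` (12 pairs at `p = 3` with two-engine EXACT `dim_𝔽₃ Sel^(3) = 2`,
`Supersingular/X678DescentRecords.lean` `checked_x6_rankZero_sha9_desc3`, kit j091546; 113 pairs at `p ≥ 5`
closed by Kurihara numbers / visibility); for those the `k = 1`, `m = 2` instance
`X6.bsdp_rankZero_of_card_selmerGroup` re-closes the twelve `p = 3` cells WITHOUT `hCT` (display file to follow).
The `k ≥ 2` instances are the typed consumer for any future pair with `ord_p #Ш_an ≥ 4` (none below 5·10⁵ on A6).

References: Wuthrich, Doc. Math. 19 (2014) Prop. 21 [Wuthrich2014]; Silverman AEC X.4.2 [SilvermanAEC2009];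
Mazur 1977 III.5 [Mazur1977]; Serre 1972 §1.11 Prop. 12, §5.4 Prop. 21 [Serre1972]; Miller 2011 Def. 1.1
[Miller2011LMS]; Grigorov–Jorza–Patrikis–Stein–Tarniţǎ 2009 [GrigorovJorzaPatrikisSteinTarnita2009];
Schaefer–Stoll 2004 [SchaeferStoll2004] (the descent engines' correctness); cell files HOME/STATUS.md.
-/

set_option autoImplicit false
set_option linter.dupNamespace false

noncomputable section

open scoped Classical

open WeierstrassCurve Literature.NumberTheory.EllipticCurves
  Literature.NumberTheory.EllipticCurves.Rank1Residual
  Literature.NumberTheory.EllipticCurves.Rank1Residual.Typed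
  Literature.NumberTheory.EllipticCurves.Wuthrich2014
  Summit.BirchSwinnertonDyer.Rank1Residual.Supersingular

namespace Summit.BirchSwinnertonDyer.BirchSwinnertonDyer.Theorems.PrintX6

/-! ### §1 Class-free: the exact prime-power Selmer count gives the LOWER half (no Cassels–Tate) -/

section ClassFree

variable (W : WeierstrassCurve ℚ) [W.IsElliptic] (p : ℕ) [hp : Fact p.Prime]

/-- **Rank `0`, no rational `p`-torsion: `#Ш(E/ℚ)[p^k] = #Sel^(p^k)(E/ℚ)`.** At analytic rank `0`
(Gross–Zagier–Kolyvagin `hGZK`: `rank E(ℚ) = 0`, so `E(ℚ)` is finite, `finite_point_of_rank_zero`) with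
`p ∤ #E(ℚ)_tors = #E(ℚ)`, multiplication by `p^k` is onto `E(ℚ)` and the PROVED fundamental exact sequence
(Silverman X.4.2(a), `selmer_exact_holds`) identifies `Sel^(p^k)(E/ℚ)` with `Ш(E/ℚ)[p^k]`
(`card_torsionBy_sha_eq_card_selmerGroup_of_coprime`). [cite: SilvermanAEC2009, Thm X.4.2(a)] -/
theorem card_torsionBy_sha_primePow_eq_card_selmerGroup
    (hGZK : rank_eq_analyticRank_of_analyticRank_le_one) (hr : W.analyticRank = 0)
    (htors : ¬ p ∣ W.torsionOrder) (k : ℕ) :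
    Nat.card (AddSubgroup.torsionBy W.sha (p ^ k : ℕ)) =
      Nat.card (W.selmerGroup ((p ^ k : ℕ) : ℤ)) := by
  have hmw0 : W.mordellWeilRank = 0 := by rw [(hGZK W (by omega)).1, hr]
  haveI : Finite W.toAffine.Point := W.finite_point_of_rank_zero hmw0
  have hcop : (Nat.card W.toAffine.Point).Coprime (p ^ k) := by
    rw [W.natCard_point_eq_torsionOrder]
    exact (Nat.coprime_comm.mp ((Nat.Prime.coprime_iff_not_dvd hp.out).mpr htors)).pow_right k
  exact card_torsionBy_sha_eq_card_selmerGroup_of_coprime W (pow_ne_zero k hp.out.ne_zero) hcop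

/-- **The LOWER half from ONE exact prime-power descent, class-free, Cassels–Tate-free.** At a pair with
`ord_{s=1} L(E,s) = 0`, `p ∤ #E(ℚ)_tors`, `#Ш(E/ℚ)_an = q` and the certificate line
`#Sel^(p^k)(E/ℚ) = p^m` with `ord_p q ≤ m`: `MissingLowerBoundAt W p` (`ord_p #Ш_an ≤ ord_p #Ш`). Chain:
`#Ш[p^k] = #Sel^(p^k) = p^m` (`card_torsionBy_sha_primePow_eq_card_selmerGroup`), `Ш[p^k] ≤ Ш` finite (GZK)
so `p^m ∣ #Ш` (Lagrange) and `m ≤ ord_p #Ш`. No upper-bound input, no image hypothesis, no pairing.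
[cite: SilvermanAEC2009, Thm X.4.2(a)] [cite: Miller2011LMS, Def. 1.1 (arXiv:1010.2431 p. 3)] -/
theorem missingLowerBoundAt_of_card_selmerGroup_primePow
    (hGZK : rank_eq_analyticRank_of_analyticRank_le_one) (hr : W.analyticRank = 0)
    (htors : ¬ p ∣ W.torsionOrder) {k m : ℕ}
    (hcard : Nat.card (W.selmerGroup ((p ^ k : ℕ) : ℤ)) = p ^ m)
    {q : ℚ} (hq : shaAn W = (q : ℂ)) (hv : padicValRat p q ≤ m) : MissingLowerBoundAt W p := by
  haveI : Finite W.sha := (hGZK W (by omega)).2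
  have hsha : Nat.card (AddSubgroup.torsionBy W.sha (p ^ k : ℕ)) = p ^ m := by
    rw [card_torsionBy_sha_primePow_eq_card_selmerGroup W p hGZK hr htors k, hcard]
  have hdvd : p ^ m ∣ W.shaOrder := by
    rw [WeierstrassCurve.shaOrder, ← hsha]
    exact AddSubgroup.card_addSubgroup_dvd_card _
  have hle : m ≤ padicValNat p W.shaOrder :=
    (padicValNat_dvd_iff_le (WeierstrassCurve.shaOrder_pos W ‹_›).ne').mp hdvd
  refine ⟨q, hq, hv.trans ?_⟩
  exact_mod_cast hle

variable [W.IsGloballyMinimal]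

/-- **Class-free rank-`0` closure from PUBLISHED theorems + ONE exact prime-power descent.** `p` odd, `E` not
additive at `p`, `ρ̄_{E,p}` surjective or Borel (the printed provisos of Wuthrich 2014 Prop. 21, `hW` — Kato's
upper bound `ord_p #Ш ≤ ord_p #Ш_an`), `ord_{s=1} L(E,s) = 0`, `p ∤ #E(ℚ)_tors`, `#Ш_an = q`, and
`#Sel^(p^k)(E/ℚ) = p^m` with `ord_p q ≤ m` ⟹ Miller's `BSD(E,p)`. (`hGZK` = bsd.S17, `hmod` = modularity for
`r_an = 0 ⇒ L(E,1) ≠ 0`.) Per pair; not a class theorem. [cite: Wuthrich2014, Prop. 21 (p. 400)]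
[cite: SilvermanAEC2009, Thm X.4.2(a)] [cite: Miller2011LMS, §1 and Def. 1.1] -/
theorem bsdp_of_wuthrich_of_card_selmerGroup_primePow (hW : sha_dvd_analyticSha)
    (hGZK : rank_eq_analyticRank_of_analyticRank_le_one) (hmod : hasEntireLFunction_rat)
    (hp2 : p ≠ 2) (hr : W.analyticRank = 0)
    (hadd : ¬ ((W.baseChange ℚ_[p]).minimal ℤ_[p]).HasAdditiveReduction ℤ_[p])
    (himg : ¬ W.HasIrreducibleModPGaloisRep p ∨ W.HasSurjectiveModNGaloisRep p)
    (htors : ¬ p ∣ W.torsionOrder) {k m : ℕ}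
    (hcard : Nat.card (W.selmerGroup ((p ^ k : ℕ) : ℤ)) = p ^ m)
    {q : ℚ} (hq : shaAn W = (q : ℂ)) (hv : padicValRat p q ≤ m) : BSDp W p :=
  bsdp_of_missingLowerBoundAt_of_wuthrich W p hW hGZK hmod hp2 hr hadd himg
    (missingLowerBoundAt_of_card_selmerGroup_primePow W p hGZK hr htors hcard hq hv)

end ClassFree

/-! ### §2 The leaf `ClassX6 ∧ r_an = 0`: every side condition discharged from the class predicate -/

section Leaf

variable (W : WeierstrassCurve ℚ) [W.IsElliptic] [W.IsGloballyMinimal] (p : ℕ) [hp : Fact p.Prime]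

/-- **Leaf A6 (X6 ∧ r_an = 0), odd `p`: `BSD(E,p)` from the three PUBLISHED facts + ONE exact `p^k`-descent
certificate `#Sel^(p^k)(E/ℚ) = p^m` with `ord_p #Ш_an ≤ m`.** Discharge through the class predicate: not
additive at `p` (good reduction, `ClassX6 ⊆ GoodSS`), Wuthrich's image proviso (`ClassX6.surj`: Serre 1972
Prop. 21 i)), `p ∤ #E(ℚ)_tors` (`ClassX6.irr`, Serre 1972 Prop. 12, + Mazur: `not_dvd_torsionOrder_of_irr`).
Named facts displayed: `hW` (Wuthrich 2014 Prop. 21 = Kato's bound), `hGZK` (bsd.S17), `hmod` (modularity); NO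
Cassels–Tate. Per pair (the certificate is per curve); NOT a class theorem; beyond-print: no.
[cite: Wuthrich2014, Prop. 21 (p. 400)] [cite: SilvermanAEC2009, Thm X.4.2(a)]
[cite: Serre1972, §1.11 Prop. 12 and §5.4 Prop. 21 i)] [cite: Miller2011LMS, §1 and Def. 1.1] -/
theorem X6.bsdp_rankZero_of_card_selmerGroup_primePow (hW : sha_dvd_analyticSha)
    (hGZK : rank_eq_analyticRank_of_analyticRank_le_one) (hmod : hasEntireLFunction_rat)
    (hp2 : p ≠ 2) (hX : ClassX6 W p) (hr : W.analyticRank = 0) {k m : ℕ}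
    (hcard : Nat.card (W.selmerGroup ((p ^ k : ℕ) : ℤ)) = p ^ m)
    {q : ℚ} (hq : shaAn W = (q : ℂ)) (hv : padicValRat p q ≤ m) : BSDp W p :=
  X6.bsdp_of_missingLowerBoundAt_of_analyticRank_eq_zero W p hW hGZK hmod hp2 hX hr
    (PrintX6.missingLowerBoundAt_of_card_selmerGroup_primePow W p hGZK hr
      (not_dvd_torsionOrder_of_irr W p (ClassX6.irr W p hp2 hX)) hcard hq hv)

/-- **Leaf A6, the first-descent instance (`k = 1`)**: `#Sel^(p)(E/ℚ) = p^m` with `ord_p #Ш_an ≤ m` ⟹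
`BSD(E,p)`. This is the shape of every non-unit A6 pair of record (`ord_p #Ш_an = 2`, `dim_𝔽_p Sel^(p) = 2`;
at `p = 3`: the twelve rows of `checked_x6_rankZero_sha9_desc3`). [cite: Wuthrich2014, Prop. 21 (p. 400)]
[cite: SilvermanAEC2009, Thm X.4.2(a)] [cite: Miller2011LMS, §1 and Def. 1.1] -/
theorem X6.bsdp_rankZero_of_card_selmerGroup (hW : sha_dvd_analyticSha)
    (hGZK : rank_eq_analyticRank_of_analyticRank_le_one) (hmod : hasEntireLFunction_rat)
    (hp2 : p ≠ 2) (hX : ClassX6 W p) (hr : W.analyticRank = 0) {m : ℕ}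
    (hcard : Nat.card (W.selmerGroup (p : ℤ)) = p ^ m)
    {q : ℚ} (hq : shaAn W = (q : ℂ)) (hv : padicValRat p q ≤ m) : BSDp W p :=
  X6.bsdp_rankZero_of_card_selmerGroup_primePow W p hW hGZK hmod hp2 hX hr (k := 1)
    (by rw [pow_one]; exact hcard) hq hv

/-- **The exact order of `Ш[p^∞]` on the leaf** (the strategy sentence's conclusion
`#Ш(E/ℚ)[p^∞] = p^{ord_p #Ш_an}`): from the same inputs with `ord_p #Ш_an = m` exactly, the `p`-primary part of
`Ш(E/ℚ)` is finite of order `p^m`. (`BSD(E,p)` gives `ord_p #Ш_an = ord_p #Ш(p)` and `#Ш(p)` is a power of `p`.)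
[cite: Miller2011LMS, Def. 1.1 (arXiv:1010.2431 p. 3)] [cite: Wuthrich2014, Prop. 21 (p. 400)] -/
theorem X6.card_primaryComponent_sha_eq_of_card_selmerGroup_primePow (hW : sha_dvd_analyticSha)
    (hGZK : rank_eq_analyticRank_of_analyticRank_le_one) (hmod : hasEntireLFunction_rat)
    (hp2 : p ≠ 2) (hX : ClassX6 W p) (hr : W.analyticRank = 0) {k m : ℕ}
    (hcard : Nat.card (W.selmerGroup ((p ^ k : ℕ) : ℤ)) = p ^ m)
    {q : ℚ} (hq : shaAn W = (q : ℂ)) (hv : padicValRat p q = m) :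
    Nat.card (AddCommGroup.primaryComponent W.sha p) = p ^ m := by
  obtain ⟨-, hfin, q', hq', hval⟩ :=
    X6.bsdp_rankZero_of_card_selmerGroup_primePow W p hW hGZK hmod hp2 hX hr hcard hq hv.le
  haveI := hfin
  have hqq : q' = q := by exact_mod_cast hq'.symm.trans hq
  subst hqq
  obtain ⟨n, hn⟩ := exists_card_addPrimaryComponent_eq_pow (A := W.sha) p
  rw [hn, padicValNat.prime_pow, hv] at hval
  have hnm : n = m := by exact_mod_cast hval.symm
  rw [hn, hnm]

/-! ### §3 Completeness of the road on the leaf: `BSD(E,p)` forces the certificate -/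

omit [W.IsElliptic] [W.IsGloballyMinimal] in
/-- For a finite abelian group: `A[p^k]` is the whole `p`-primary part as soon as `p^k ≥ #A(p)`, i.e.
`ord_p #A ≤ k` — every element of `p`-power order has order dividing `#A(p) = p^{ord_p #A}` (Lagrange).
[folklore] -/
theorem card_torsionBy_sha_primePow_eq_card_primaryComponent [Finite W.sha] {k : ℕ}
    (hk : padicValNat p W.shaOrder ≤ k) :
    Nat.card (AddSubgroup.torsionBy W.sha (p ^ k : ℕ)) =
      Nat.card (AddCommGroup.primaryComponent W.sha p) := by
  have hP : Nat.card (AddCommGroup.primaryComponent W.sha p) = p ^ padicValNat p W.shaOrder := by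
    rw [card_addPrimaryComponent_eq_pow, Nat.factorization_def _ hp.out]
    rfl
  have heq : AddSubgroup.torsionBy W.sha (p ^ k : ℕ) = AddCommGroup.primaryComponent W.sha p := by
    ext x
    rw [AddSubgroup.torsionBy.nsmul_iff, AddCommGroup.mem_primaryComponent]
    constructor
    · intro hx
      exact ⟨k, hx⟩
    · intro hx
      have hmem : x ∈ AddCommGroup.primaryComponent W.sha p :=
        AddCommGroup.mem_primaryComponent.mpr hx
      have hord : addOrderOf (⟨x, hmem⟩ : AddCommGroup.primaryComponent W.sha p) ∣ p ^ k :=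
        (addOrderOf_dvd_natCard _).trans (by rw [hP]; exact pow_dvd_pow p hk)
      have h := addOrderOf_dvd_iff_nsmul_eq_zero.mp hord
      simpa only [AddSubgroupClass.coe_nsmul, ZeroMemClass.coe_zero] using congrArg Subtype.val h
  rw [heq]

/-- **Completeness of the certificate road on the leaf.** Conversely, at an X6 ∧ r_an = 0 pair with odd `p`,
`BSD(E,p)` (with `#Ш_an = q`) FORCES the certificate: for every `k ≥ ord_p #Ш(E/ℚ)` the exact count is
`#Sel^(p^k)(E/ℚ) = p^{ord_p q}` (and `ord_p q ≥ 0`). Inputs: GZK only (`Ш` finite, rank `0`); `E(ℚ)[p] = 0` from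
`ClassX6.irr`. So the per-pair certificate is not stronger than the leaf's obligation.
[cite: SilvermanAEC2009, Thm X.4.2(a)] [cite: Miller2011LMS, Def. 1.1 (arXiv:1010.2431 p. 3)] -/
theorem X6.card_selmerGroup_primePow_eq_of_bsdp
    (hGZK : rank_eq_analyticRank_of_analyticRank_le_one)
    (hp2 : p ≠ 2) (hX : ClassX6 W p) (hr : W.analyticRank = 0) (hbsd : BSDp W p)
    {q : ℚ} (hq : shaAn W = (q : ℂ)) {k : ℕ} (hk : padicValNat p W.shaOrder ≤ k) :
    ∃ m : ℕ, Nat.card (W.selmerGroup ((p ^ k : ℕ) : ℤ)) = p ^ m ∧ padicValRat p q = m := by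
  haveI : Finite W.sha := (hGZK W (by omega)).2
  obtain ⟨-, -, q', hq', hval⟩ := hbsd
  have hqq : q' = q := by exact_mod_cast hq'.symm.trans hq
  subst hqq
  refine ⟨padicValNat p W.shaOrder, ?_, ?_⟩
  · rw [← card_torsionBy_sha_primePow_eq_card_selmerGroup W p hGZK hr
      (not_dvd_torsionOrder_of_irr W p (ClassX6.irr W p hp2 hX)) k,
      card_torsionBy_sha_primePow_eq_card_primaryComponent W p hk, card_addPrimaryComponent_eq_pow,
      Nat.factorization_def _ hp.out]
    rfl
  · rw [hval, WeierstrassCurve.shaOrder, padicValNat_card_addPrimaryComponent]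

/-- **Leaf A6, odd `p`: `BSD(E,p)` ⟺ an exact prime-power descent certificate matching `ord_p #Ш_an`**, granted
the three PUBLISHED facts (Wuthrich 2014 Prop. 21 `hW`, GZK `hGZK`, modularity `hmod`) and with `#Ш_an = q`:
`BSDp W p ↔ ∃ k m, #Sel^(p^k)(E/ℚ) = p^m ∧ ord_p q = m`. (→) `X6.card_selmerGroup_primePow_eq_of_bsdp` with
`k = ord_p #Ш`; (←) `X6.bsdp_rankZero_of_card_selmerGroup_primePow`. The kernel form of the seat's report: on
the leaf the explicit-descent road is EXACTLY as strong as `BSD(E,p)` pair by pair, and what no certificate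
supplies is a UNIFORM (class-wide) reason — the lower half `MissingLowerBoundAt`, i.e. crux
`KobayashiLowerHalfSemistable` (stmt-19000). [cite: Wuthrich2014, Prop. 21 (p. 400)]
[cite: SilvermanAEC2009, Thm X.4.2(a)] [cite: Miller2011LMS, §1 and Def. 1.1] -/
theorem X6.bsdp_rankZero_iff_exists_card_selmerGroup_primePow (hW : sha_dvd_analyticSha)
    (hGZK : rank_eq_analyticRank_of_analyticRank_le_one) (hmod : hasEntireLFunction_rat)
    (hp2 : p ≠ 2) (hX : ClassX6 W p) (hr : W.analyticRank = 0) {q : ℚ} (hq : shaAn W = (q : ℂ)) :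
    BSDp W p ↔
      ∃ k m : ℕ, Nat.card (W.selmerGroup ((p ^ k : ℕ) : ℤ)) = p ^ m ∧ padicValRat p q = m := by
  constructor
  · intro hbsd
    obtain ⟨m, hcard, hv⟩ :=
      X6.card_selmerGroup_primePow_eq_of_bsdp W p hGZK hp2 hX hr hbsd hq (k := padicValNat p W.shaOrder)
        le_rfl
    exact ⟨_, m, hcard, hv⟩
  · rintro ⟨k, m, hcard, hv⟩
    exact X6.bsdp_rankZero_of_card_selmerGroup_primePow W p hW hGZK hmod hp2 hX hr hcard hq hv.le

/-- **What is missing CLASS-WIDE on the leaf, named.** The certificate hypothesis of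
`X6.bsdp_rankZero_of_card_selmerGroup_primePow` is, pair by pair, equivalent to the typed LOWER half
`MissingLowerBoundAt W p` granted the published facts (this direction: certificate ⟹ lower half, class-free part
`missingLowerBoundAt_of_card_selmerGroup_primePow` with `p ∤ #E(ℚ)_tors` discharged from `ClassX6.irr`). The
uniform statement «∀ X6 ∧ r_an = 0 pairs, MissingLowerBoundAt» is the Eisenstein half of Kobayashi's signed
main conjecture (crux `KobayashiLowerHalfSemistable`, item 19000; BSTW arXiv:2409.01350 Thm. 1.3, PRE) — the
residual this road cannot reach. [cite: SilvermanAEC2009, Thm X.4.2(a)] [cite: Miller2011LMS, Def. 1.1] -/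
theorem X6.missingLowerBoundAt_rankZero_of_card_selmerGroup_primePow
    (hGZK : rank_eq_analyticRank_of_analyticRank_le_one)
    (hp2 : p ≠ 2) (hX : ClassX6 W p) (hr : W.analyticRank = 0) {k m : ℕ}
    (hcard : Nat.card (W.selmerGroup ((p ^ k : ℕ) : ℤ)) = p ^ m)
    {q : ℚ} (hq : shaAn W = (q : ℂ)) (hv : padicValRat p q ≤ m) : MissingLowerBoundAt W p :=
  PrintX6.missingLowerBoundAt_of_card_selmerGroup_primePow W p hGZK hr
    (not_dvd_torsionOrder_of_irr W p (ClassX6.irr W p hp2 hX)) hcard hq hv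

end Leaf

end Summit.BirchSwinnertonDyer.BirchSwinnertonDyer.Theorems.PrintX6

end
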